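import Summits.ResolutionOfSingularities.ResolutionOfSingularities.Theorems.WeightedInvariantJOpenPresentationFlatCylinder
import Summits.ResolutionOfSingularities.ResolutionOfSingularities.Theorems.WeightedInvariantIota3Regimes
import Literature.AlgebraicGeometry.Resolution.CobordantBlowupRegularCentre
import HarnessLib

/-!
# (open″)≤3 for the pair of record `(ι₃ᵗ, J₃ᵗ)` — (o52-A) THE CURVE BODY: along a height-two top stratum `V(𝔭)`
# (`dim A_𝔭 = 2`, `F` not of monomial type at `A_𝔭`) presented by a regular pair `(x, g)` descended to `A`, the system
# `U = (x, g)`, `W = (1, b_max)` presents `J₃ᵗ` on a basic open and cuts out the top `ι₃ᵗ`-stratum exactly — MODULO the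
# tie-freeness of `V(𝔭)` near `𝔪` (door `HypersurfaceCentreConstruction`, stmt-ResolutionOfSingularities-19897; P3 rung clause h8
# `JOpenPresentationForallSingLE 3 p Iota3.iotaFlatT Iota3.jFlatT`; DEAL (o52) SPLIT of res-L1-w43-plan-1, part (o52-A), hand res-D-brk-1)

Topic: `Summits/ResolutionOfSingularities/ResolutionOfSingularities/Theorems`. Helper for the door item
`HypersurfaceCentreConstruction` (stmt-ResolutionOfSingularities-19897, route `WeightedInvariant`), line `local-engine`
(L W4.3), def-free.  THE REGIME: the generic prime `P₀ᵗ` of the top `(ν ; ε ; τ)`-stratum of the position `S = A_𝔪` (regular,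
`dim S ≤ 3`) has HEIGHT TWO: the CURVE° positions of dimension 3 (res-L1-w43-plan-1 IOTA3-DESIGN v1.3 §8.4: `dim S ⧸ P₀ = 1`, no
tie) AND the non-monomial positions of dimension 2 (`P₀ᵗ = 𝔪_S`).  In both cases `𝔭 := P₀ᵗ ∩ A` has `dim A_𝔭 = 2`, `F/1` is
NOT of monomial type at `A_𝔭`, and a regular pair `(x, g)` of `A` presents the P2 object `jContact (A_𝔭) F` (`(x, g) A_𝔭 =
𝔪_{A_𝔭}`, `g` a contact parameter reaching the terminal level `b_max`) with `(x, g) A_𝔪 = 𝔭 A_𝔪` and independent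
differentials at `𝔪` — at dimension 3 this is res-D-brk-1's MAXIMISER DESCENT (`ContactCylinder.Descent.exists_pair_maximiser`,
p532512), at dimension 2 any regular system of parameters of `A_𝔭 = A_𝔪` through a maximiser.

THE BODY (`jOpenPresentationLE_body_curve`): the literal ∃-body of `JOpenPresentationForallSingLE 3 p iotaFlatT jFlatT` at
`(A, 𝔪, F)` with `N = 2`, `U = ![x, g]`, `W = ![1, b_max]`, GIVEN (besides the data above) the ORDER form of the regime
(`hEord`: the equimultiple locus of `A_𝔪` is `V(𝔭 A_𝔪)`) and ONE INPUT:
(TIE-FREE) on some `D(h_τ) ∋ 𝔪`, no prime `𝔮 ⊇ 𝔭` of local dimension `≤ 3` is a tie position (`¬ Iota3.IsTiePosition (A_𝔮) F`).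
At a closed point of a threefold this is the FINITENESS OF THE TIE POINTS on the curve `V(𝔭)` (res-type-047's (c8τ):
`TieFinite.finite_tiePrimes` p540078 / `tiePoints_finite_of_curveFinite'`); at a non-closed model prime (the orbit-generic points the
E2 consumer reads, registrar RULING #8) it is the same statement for the height-one primes of `A ⧸ 𝔭` near `𝔪 ⧸ 𝔭`, which no
tree theorem supplies yet — hence an explicit hypothesis, named here for the registrar to key.

ROUTE: the engine `JOpenLE3.jOpenPresentation_body_flat_of_stratumIff` (p550699) over `𝔭`, fed with
(ι₀-IFF) = res-type-098's ORDER stratum iff on a basic open (`GenericEquimultiplicity.stratumIff_iotaOrd`, p515109; its (strat)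
input is `hEord`, its (adm) input is `ord ≥ 2` along `V(𝔭 A_𝔪)`) UPGRADED to `ι₀ = (ν ; ε ; τ)`: along `V(𝔭) ∩ D(h)` the letter
`ε` vanishes — the equimultiple locus of `A_𝔮` is `V(𝔭 A_𝔮) = V((x, g) A_𝔮)` (the order iff read at the generizations of `𝔮`)
and `A_𝔮 ⧸ (x, g)` is regular (`x, g` keep independent differentials on a basic open, Literature `CotangentIndependenceSpread`;
Literature `isRegularLocalRing_quotient_span_range`) — and `τ` vanishes by (TIE-FREE); and (J-PRES) = res-D-brk-1's
`ContactCylinder.cylinder_open_presentation` (p524363).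

## Contents (sorry-free, standard axioms; NO definitions)

* `iotaEps_atPrime_eq_zero_of_pair` — `ε (A_𝔮) F = 0` at a prime `𝔮 ⊇ 𝔭` where `A_𝔮` is regular, `(x, g)` have independent
  differentials, the equimultiple locus of `A_𝔮` is `V(𝔭 A_𝔮)`, and `V(𝔭) = V(x, g)` among the primes below `𝔮`.
* **`jOpenPresentationLE_body_curve`** — the body above.

[OURS · L1 W4.3 · (o52-A)]  Replaces the role of NO printed item; NOT a statement of the manuscript
[claim: Hironaka2017, status: under-review]. AI work, weaker than expert review.  Pure commutative algebra; no named facts.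

## References

* V. Cossart, O. Piltant, *Resolution of singularities of threefolds in positive characteristic I*, J. Algebra 320 (2008),
  Prop. 4.2 (generic behaviour of the order along a regular prime). [CossartPiltant2008]
* H. Matsumura, *Commutative Ring Theory* (1987), Thm. 14.2 (quotients by parts of regular systems), Thm. 4.3. [Matsumura1987]
* res-L1-w43-plan-1, IOTA3-DESIGN v1.3 §8.4 row CURVE° and DEAL (o52) SPLIT (OURS, AI planning); res-type-047 D2-INCHART-SPEC v2 (OURS).
-/

noncomputable section

open IsLocalRing Literature.AlgebraicGeometry.Resolution
open Summit.ResolutionOfSingularities.ResolutionOfSingularities.Cruxes.HypersurfaceCentreConstruction.LocalEngine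
open Summit.ResolutionOfSingularities.ResolutionOfSingularities.Cruxes.HypersurfaceCentreConstruction.LocalEngine.Iota3

set_option linter.dupNamespace false -- mandated namespace of this single-conjunct summit

namespace Summit.ResolutionOfSingularities.ResolutionOfSingularities.Theorems

namespace JOpenLE3

open ContactCylinder

/-! ## `ε` vanishes along a regularly presented equimultiple curve -/

/-- **`ε (A_𝔮) F = 0` along a regularly presented stratum.**  `𝔭 ≤ 𝔮` primes, `A_𝔮` regular; `U : Fin N → A` in `𝔭` with
independent differentials at `A_𝔮`; among the primes `𝔮₀ ⊆ 𝔮`: `(∀ i, U i ∈ 𝔮₀) ↔ 𝔭 ≤ 𝔮₀`; and the equimultiple locus of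
`(A_𝔮, F)` is `V(𝔭 A_𝔮)`.  Then the equimultiple locus is `V((U) A_𝔮)` with `A_𝔮 ⧸ (U)` regular, so it is a permissible centre:
`iotaEps (A_𝔮) F = 0`. [OURS · L1 W4.3 · (o52-A)] -/
theorem iotaEps_atPrime_eq_zero_of_pair {A : Type} [CommRing A] (𝔭 𝔮 : Ideal A) [𝔭.IsPrime] [𝔮.IsPrime]
    [IsRegularLocalRing (Localization.AtPrime 𝔮)] (F : A) {N : ℕ} (U : Fin N → A)
    (hU𝔮 : ∀ i, algebraMap A (Localization.AtPrime 𝔮) (U i) ∈ maximalIdeal (Localization.AtPrime 𝔮))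
    (hli : LinearIndependent (ResidueField (Localization.AtPrime 𝔮)) fun i =>
      (maximalIdeal (Localization.AtPrime 𝔮)).toCotangent ⟨algebraMap A _ (U i), hU𝔮 i⟩)
    (hbridge : ∀ (𝔮₀ : Ideal A) [𝔮₀.IsPrime], 𝔮₀ ≤ 𝔮 → ((∀ i, U i ∈ 𝔮₀) ↔ 𝔭 ≤ 𝔮₀))
    (hE : topStratum iotaOrd (Localization.AtPrime 𝔮) (algebraMap A (Localization.AtPrime 𝔮) F) =
      {𝔮₀' | 𝔭.map (algebraMap A (Localization.AtPrime 𝔮)) ≤ 𝔮₀'.asIdeal}) :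
    iotaEps (Localization.AtPrime 𝔮) (algebraMap A (Localization.AtPrime 𝔮) F) = 0 := by
  set P : Ideal (Localization.AtPrime 𝔮) := Ideal.span (Set.range fun i => algebraMap A (Localization.AtPrime 𝔮) (U i))
    with hP
  have hreg : IsRegularLocalRing (Localization.AtPrime 𝔮 ⧸ P) :=
    isRegularLocalRing_quotient_span_range (fun i => algebraMap A (Localization.AtPrime 𝔮) (U i)) hU𝔮 hli
  haveI : IsDomain (Localization.AtPrime 𝔮 ⧸ P) := isDomain_of_isRegularLocalRing _
  have hprime : P.IsPrime := (Ideal.Quotient.isDomain_iff_prime _).mp inferInstance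
  rw [iotaEps_eq_zero_iff]
  refine ⟨P, hprime, hreg, ?_⟩
  rw [hE]
  ext 𝔮₀'
  simp only [Set.mem_setOf_eq]
  have hle : 𝔮₀'.asIdeal.comap (algebraMap A (Localization.AtPrime 𝔮)) ≤ 𝔮 := comap_le_of_isPrime_atPrime 𝔮 _
  rw [Ideal.map_le_iff_le_comap, ← hbridge _ hle, hP, Ideal.span_le, Set.range_subset_iff]
  rfl


/-! ## (o52-A) the body -/

/-- **(open″)≤3 BODY AT A CURVE-TYPE (height-two) POSITION for the pair of record `(iotaFlatT, jFlatT)`, modulo tie-freeness.**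
Position: `k` perfect, `A` of finite type, primes `𝔭 ≤ 𝔪`, `A_𝔪` regular of dimension `≤ 3`, `A_𝔭` regular of dimension `2`;
`x, g ∈ A` with `(x, g) A_𝔭 = 𝔪_{A_𝔭}`, `(x, g) A_𝔪 = 𝔭 A_𝔪`, independent differentials at `A_𝔪`; the P2 data at `A_𝔭` (`F/1 ≠ 0`
not of monomial type, `g/1` a contact parameter reaching the terminal level `b_max`); the regime in ORDER form (`hEord`: the
equimultiple locus of `A_𝔪` is `V(𝔭 A_𝔪)`); and (TIE-FREE): on some `D(h_τ) ∋ 𝔪` no prime `𝔮 ⊇ 𝔭` of local dimension `≤ 3` is a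
tie position.  Conclusion: the literal ∃-body of `JOpenPresentationForallSingLE 3 p iotaFlatT jFlatT` at `(A, 𝔪, F)` with `N = 2`,
`U = ![x, g]`, `W = ![1, b_max]`. [OURS · L1 W4.3 · (o52-A)] -/
theorem jOpenPresentationLE_body_curve
    (k : Type) [Field k] [PerfectField k] (A : Type) [CommRing A] [Algebra k A] [Algebra.FiniteType k A]
    (𝔪 : Ideal A) [𝔪.IsPrime] [h𝔪 : IsRegularLocalRing (Localization.AtPrime 𝔪)]
    (hdim𝔪 : ringKrullDim (Localization.AtPrime 𝔪) ≤ 3) (F : A)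
    (𝔭 : Ideal A) [𝔭.IsPrime] (h𝔭𝔪 : 𝔭 ≤ 𝔪) [IsRegularLocalRing (Localization.AtPrime 𝔭)]
    (hdim𝔭 : ringKrullDim (Localization.AtPrime 𝔭) = 2) (x g : A)
    (hxg𝔭 : (Ideal.span {x, g}).map (algebraMap A (Localization.AtPrime 𝔭)) = maximalIdeal (Localization.AtPrime 𝔭))
    (hxg𝔪 : (Ideal.span {x, g}).map (algebraMap A (Localization.AtPrime 𝔪)) = 𝔭.map (algebraMap A (Localization.AtPrime 𝔪)))
    (hU𝔪 : ∀ i, algebraMap A (Localization.AtPrime 𝔪) ((![x, g] : Fin 2 → A) i) ∈ maximalIdeal (Localization.AtPrime 𝔪))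
    (hli𝔪 : LinearIndependent (ResidueField (Localization.AtPrime 𝔪)) fun i =>
      (maximalIdeal (Localization.AtPrime 𝔪)).toCotangent ⟨algebraMap A _ ((![x, g] : Fin 2 → A) i), hU𝔪 i⟩)
    (hF0 : algebraMap A (Localization.AtPrime 𝔭) F ≠ 0)
    (hnm : ¬ IsMonomialType (algebraMap A (Localization.AtPrime 𝔭) F))
    (hreach : algebraMap A (Localization.AtPrime 𝔭) F ∈
      contactFiltration (algebraMap A (Localization.AtPrime 𝔭) g) (bMax (algebraMap A (Localization.AtPrime 𝔭) F))
        (bMax (algebraMap A (Localization.AtPrime 𝔭) F) * (adicOrder (algebraMap A (Localization.AtPrime 𝔭) F)).toNat))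
    (hEord : topStratum iotaOrd (Localization.AtPrime 𝔪) (algebraMap A (Localization.AtPrime 𝔪) F) =
      {𝔮 | 𝔭.map (algebraMap A (Localization.AtPrime 𝔪)) ≤ 𝔮.asIdeal})
    {hτ₀ : A} (hhτ₀ : hτ₀ ∉ 𝔪)
    (hτ : ∀ (𝔮 : Ideal A) [𝔮.IsPrime], hτ₀ ∉ 𝔮 → 𝔭 ≤ 𝔮 → ringKrullDim (Localization.AtPrime 𝔮) ≤ 3 →
      ¬ IsTiePosition (Localization.AtPrime 𝔮) (algebraMap A (Localization.AtPrime 𝔮) F)) :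
    ∃ h : A, h ∉ 𝔪 ∧ ∃ (N : ℕ) (U : Fin N → A) (W : Fin N → ℕ), (∀ i, 0 < W i) ∧
      (∃ hU : ∀ i, algebraMap A (Localization.AtPrime 𝔪) (U i) ∈ maximalIdeal (Localization.AtPrime 𝔪),
        LinearIndependent (ResidueField (Localization.AtPrime 𝔪))
          (fun i => ((maximalIdeal (Localization.AtPrime 𝔪)).toCotangent ⟨_, hU i⟩ :
            CotangentSpace (Localization.AtPrime 𝔪)))) ∧
      ∀ (𝔮 : Ideal A) [𝔮.IsPrime], h ∉ 𝔮 → ringKrullDim (Localization.AtPrime 𝔮) ≤ 3 →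
        ((∀ i, U i ∈ 𝔮) ↔
          (algebraMap A (Localization.AtPrime 𝔮) F ∈ (maximalIdeal (Localization.AtPrime 𝔮)) ^ 2 ∧
            iotaFlatT (Localization.AtPrime 𝔮) (algebraMap A (Localization.AtPrime 𝔮) F) =
              iotaFlatT (Localization.AtPrime 𝔪) (algebraMap A (Localization.AtPrime 𝔪) F))) ∧
        ((∀ i, U i ∈ 𝔮) → ∀ m : ℕ,
          jFlatT (Localization.AtPrime 𝔮) (algebraMap A (Localization.AtPrime 𝔮) F) m =
            (weightedMonomialIdeal U W m).map (algebraMap A (Localization.AtPrime 𝔮))) := by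
  classical
  haveI : IsNoetherianRing A := Algebra.FiniteType.isNoetherianRing k A
  haveI := isPrime_map_atPrime_of_le 𝔭 𝔪 h𝔭𝔪
  -- STEP 0: the P2 data at `A_𝔭`, unpacked (as in `jOpenPresentation_body_cylinder`)
  have hxg' : Ideal.span {algebraMap A (Localization.AtPrime 𝔭) x, algebraMap A (Localization.AtPrime 𝔭) g} =
      maximalIdeal (Localization.AtPrime 𝔭) := by
    rw [← hxg𝔭, Ideal.map_span, Set.image_pair]
  have hmem : ∀ a : A, algebraMap A (Localization.AtPrime 𝔭) a ∈ maximalIdeal (Localization.AtPrime 𝔭) → a ∈ 𝔭 :=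
    fun a ha => (IsLocalization.AtPrime.to_map_mem_maximal_iff (Localization.AtPrime 𝔭) 𝔭 a).mp ha
  have hx : x ∈ 𝔭 := hmem x (hxg' ▸ Ideal.subset_span (by simp))
  have hg : g ∈ 𝔭 := hmem g (hxg' ▸ Ideal.subset_span (by simp))
  have hU𝔭 : ∀ i, (![x, g] : Fin 2 → A) i ∈ 𝔭 := Fin.forall_fin_two.2 ⟨hx, hg⟩
  have hg2 := (LocalGameEFTSteepening.not_mem_sq_of_span_pair_eq (by exact_mod_cast hdim𝔭) hxg').2
  have hF2𝔭 := mem_sq_of_not_isMonomialType hF0 hnm ⟨_, hxg' ▸ Ideal.subset_span (by simp), hg2⟩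
  have hb := (one_le_bMax_and_reaches_of_essFiniteType k (Localization.AtPrime 𝔭) hF0 hF2𝔭 hnm).1
  have hW : ∀ i, 0 < (![1, bMax (algebraMap A (Localization.AtPrime 𝔭) F)] : Fin 2 → ℕ) i :=
    Fin.forall_fin_two.2 ⟨Nat.one_pos, hb⟩
  -- STEP 1: the order at `A_𝔪` is `≥ 2` (it is `≥ 2` at the generization `A_𝔭`); `F/1 ≠ 0` at `A_𝔪`
  have h2𝔭 : (2 : Ordinal) ≤ iotaOrd (Localization.AtPrime 𝔭) (algebraMap A (Localization.AtPrime 𝔭) F) :=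
    (StratumIff.mem_sq_iff_two_le_iotaOrd F 𝔭).mp hF2𝔭
  have h2 : (2 : Ordinal) ≤ iotaOrd (Localization.AtPrime 𝔪) (algebraMap A (Localization.AtPrime 𝔪) F) :=
    h2𝔭.trans (StratumIff.iotaOrd_localization_mono F 𝔭 𝔪 h𝔭𝔪 h𝔪)
  have hF0𝔪 : algebraMap A (Localization.AtPrime 𝔪) F ≠ 0 := by
    intro h0
    obtain ⟨s, hs⟩ := (IsLocalization.map_eq_zero_iff 𝔪.primeCompl (Localization.AtPrime 𝔪) F).mp h0
    refine hF0 ((IsLocalization.map_eq_zero_iff 𝔭.primeCompl (Localization.AtPrime 𝔭) F).mpr ?_)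
    exact ⟨⟨s, fun h => s.2 (h𝔭𝔪 h)⟩, hs⟩
  -- STEP 2: the ORDER stratum iff on a basic open (res-type-098), fed by `hEord` and `ord ≥ 2` along `V(𝔭 A_𝔪)`
  have hstrat : ∀ (𝔭' : Ideal (Localization.AtPrime 𝔪)) [𝔭'.IsPrime],
      algebraMap A (Localization.AtPrime 𝔪) F ∈ 𝔭' →
        (iotaOrd (Localization.AtPrime 𝔭') (algebraMap (Localization.AtPrime 𝔪) (Localization.AtPrime 𝔭')
            (algebraMap A (Localization.AtPrime 𝔪) F)) =
          iotaOrd (Localization.AtPrime 𝔪) (algebraMap A (Localization.AtPrime 𝔪) F) ↔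
            𝔭.map (algebraMap A (Localization.AtPrime 𝔪)) ≤ 𝔭') := by
    intro 𝔭' _ _
    have h := Set.ext_iff.mp hEord ⟨𝔭', inferInstance⟩
    rwa [ContactCylinder.mem_topStratum_iff, Set.mem_setOf_eq] at h
  have hadm : ∀ (Q : Ideal (Localization.AtPrime 𝔪)) [Q.IsPrime], 𝔭.map (algebraMap A (Localization.AtPrime 𝔪)) ≤ Q →
      algebraMap (Localization.AtPrime 𝔪) (Localization.AtPrime Q) (algebraMap A (Localization.AtPrime 𝔪) F) ∈
        maximalIdeal (Localization.AtPrime Q) ^ 2 := by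
    intro Q _ hQ
    have h := Set.ext_iff.mp hEord ⟨Q, inferInstance⟩
    rw [ContactCylinder.mem_topStratum_iff, Set.mem_setOf_eq] at h
    rw [StratumIff.mem_sq_localization_localization_iff 𝔪 Q F, StratumIff.mem_sq_iff_two_le_iotaOrd,
      ← StratumIff.iota_localization_localization_eq iotaOrd iotaOrd_isoInvariant 𝔪 Q F, h.mpr hQ]
    exact h2
  obtain ⟨h₁, hh₁, hiff⟩ := GenericEquimultiplicity.stratumIff_iotaOrd k 𝔪 F h𝔪 hF0𝔪
    (𝔭.map (algebraMap A (Localization.AtPrime 𝔪))) (fun 𝔭' _ hF => hstrat 𝔭' hF) hadm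
  rw [comap_map_atPrime_of_le 𝔭 𝔪 h𝔭𝔪] at hiff
  have hsq : ∀ (𝔮 : Ideal A) [𝔮.IsPrime], h₁ ∉ 𝔮 →
      iotaOrd (Localization.AtPrime 𝔮) (algebraMap A (Localization.AtPrime 𝔮) F) =
          iotaOrd (Localization.AtPrime 𝔪) (algebraMap A (Localization.AtPrime 𝔪) F) →
        algebraMap A (Localization.AtPrime 𝔮) F ∈ maximalIdeal (Localization.AtPrime 𝔮) ^ 2 := by
    intro 𝔮 _ _ heq
    rw [StratumIff.mem_sq_iff_two_le_iotaOrd, heq]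
    exact h2
  -- STEP 3: regularity of `A_𝔮` and independence of `(x/1, g/1)` spread from `𝔪`; the bridge `V(x, g) = V(𝔭)` near `𝔪`
  obtain ⟨f, hf𝔪, hspread⟩ := exists_notMem_forall_linearIndependent_toCotangent k 𝔪 (![x, g]) hU𝔪 hli𝔪
  obtain ⟨hb₀, hhb₀, hbridge⟩ := StratumIff.exists_forall_le_iff_comap_le 𝔪 (Ideal.span {x, g})
  have hcomap : ((Ideal.span {x, g}).map (algebraMap A (Localization.AtPrime 𝔪))).comap
      (algebraMap A (Localization.AtPrime 𝔪)) = 𝔭 := by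
    rw [hxg𝔪, comap_map_atPrime_of_le 𝔭 𝔪 h𝔭𝔪]
  have hUiff : ∀ (𝔮₀ : Ideal A) [𝔮₀.IsPrime], hb₀ ∉ 𝔮₀ → ((∀ i, (![x, g] : Fin 2 → A) i ∈ 𝔮₀) ↔ 𝔭 ≤ 𝔮₀) := by
    intro 𝔮₀ _ h𝔮₀
    rw [← hcomap, ← hbridge 𝔮₀ h𝔮₀, Ideal.span_le, Fin.forall_fin_two]
    constructor
    · rintro ⟨hx₀, hg₀⟩
      rintro y (rfl | rfl)
      · exact hx₀
      · exact hg₀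
    · intro hsub
      exact ⟨hsub (by simp), hsub (by simp)⟩
  -- STEP 4: along `V(𝔭) ∩ D(h₁ f hb₀ h_τ) ∩ {dim ≤ 3}`: `A_𝔮` regular, `(ν ; ε ; τ) (A_𝔮) = (ν ; 0 ; 0)`
  have hletters : ∀ (𝔮 : Ideal A) [𝔮.IsPrime], h₁ * f * hb₀ * hτ₀ ∉ 𝔮 → 𝔭 ≤ 𝔮 → ringKrullDim (Localization.AtPrime 𝔮) ≤ 3 →
      iotaOrd (Localization.AtPrime 𝔮) (algebraMap A (Localization.AtPrime 𝔮) F) =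
          iotaOrd (Localization.AtPrime 𝔪) (algebraMap A (Localization.AtPrime 𝔪) F) ∧
        iotaEps (Localization.AtPrime 𝔮) (algebraMap A (Localization.AtPrime 𝔮) F) = 0 ∧
        iotaTau (Localization.AtPrime 𝔮) (algebraMap A (Localization.AtPrime 𝔮) F) = 0 := by
    intro 𝔮 _ hh𝔮 h𝔭𝔮 hdim𝔮
    have hh₁𝔮 : h₁ ∉ 𝔮 := fun h => hh𝔮 (Ideal.mul_mem_right _ _ (Ideal.mul_mem_right _ _ (Ideal.mul_mem_right _ _ h)))
    have hf𝔮 : f ∉ 𝔮 := fun h => hh𝔮 (Ideal.mul_mem_right _ _ (Ideal.mul_mem_right _ _ (Ideal.mul_mem_left _ _ h)))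
    have hhb₀𝔮 : hb₀ ∉ 𝔮 := fun h => hh𝔮 (Ideal.mul_mem_right _ _ (Ideal.mul_mem_left _ _ h))
    have hhτ₀𝔮 : hτ₀ ∉ 𝔮 := fun h => hh𝔮 (Ideal.mul_mem_left _ _ h)
    obtain ⟨hreg𝔮, hXY𝔮, hli𝔮⟩ := hspread 𝔮 hf𝔮 (fun i => h𝔭𝔮 (hU𝔭 i))
    haveI := hreg𝔮
    refine ⟨((hiff 𝔮 hh₁𝔮).mp h𝔭𝔮).2, ?_, ?_⟩
    · -- `ε = 0`: the equimultiple locus of `A_𝔮` is `V(𝔭 A_𝔮) = V((x, g) A_𝔮)`, a regular germ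
      have hE𝔮 := topStratum_atPrime_eq_of_stratumIff iotaOrd iotaOrd_isoInvariant 𝔪 𝔭 F hiff hsq 𝔮 h𝔭𝔮 hh₁𝔮 hh₁𝔮
      exact iotaEps_atPrime_eq_zero_of_pair 𝔭 𝔮 F ![x, g] hXY𝔮 hli𝔮
        (fun 𝔮₀ _ h𝔮₀ => hUiff 𝔮₀ (fun h => hhb₀𝔮 (h𝔮₀ h))) hE𝔮
    · -- `τ = 0`: (TIE-FREE)
      exact (iotaTau_eq_zero_iff_not_isTiePosition hdim𝔮 _).mpr (hτ 𝔮 hhτ₀𝔮 h𝔭𝔮 hdim𝔮)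
  have hprod𝔪 : h₁ * f * hb₀ * hτ₀ ∉ 𝔪 := by
    intro hm
    rcases Ideal.IsPrime.mem_or_mem ‹𝔪.IsPrime› hm with hm | hm
    · rcases Ideal.IsPrime.mem_or_mem ‹𝔪.IsPrime› hm with hm | hm
      · exact (Ideal.IsPrime.mem_or_mem ‹𝔪.IsPrime› hm).elim hh₁ hf𝔪
      · exact hhb₀ hm
    · exact hhτ₀ hm
  have hletters𝔪 := hletters 𝔪 hprod𝔪 h𝔭𝔪 hdim𝔪
  -- STEP 5: the engine
  have key := jOpenPresentation_body_flat_of_stratumIff k A 𝔪 hdim𝔪 F h2 𝔭 h𝔭𝔪 hdim𝔭.le ![x, g]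
    ![1, bMax (algebraMap A (Localization.AtPrime 𝔭) F)] ?hUp hU𝔪 hli𝔪 (h₀ := f) hf𝔪 ?hpres
    (h₁ := h₁ * f * hb₀ * hτ₀) hprod𝔪 ?hiff
  case hUp =>
    rw [← hxg𝔪]
    congr 1
    refine le_antisymm (Ideal.span_le.mpr ?_) (Ideal.span_le.mpr ?_)
    · rintro y ⟨i, rfl⟩
      fin_cases i
      · exact Ideal.subset_span (by simp)
      · exact Ideal.subset_span (by simp)
    · rintro y (rfl | rfl)
      · exact Ideal.subset_span ⟨0, rfl⟩
      · exact Ideal.subset_span ⟨1, rfl⟩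
  case hpres =>
    -- (J-PRES): res-D-brk-1's `cylinder_open_presentation` at `𝔮`
    intro 𝔮 _ hf𝔮 h𝔭𝔮 hdim𝔮 hreg𝔮 hind m
    obtain ⟨hXY𝔮, hli𝔮⟩ := hind
    haveI := hreg𝔮
    haveI := isPrime_map_atPrime_of_le 𝔭 𝔮 h𝔭𝔮
    have hXY : ∀ i, (![algebraMap A (Localization.AtPrime 𝔮) x, algebraMap A (Localization.AtPrime 𝔮) g] : Fin 2 → _) i ∈
        maximalIdeal (Localization.AtPrime 𝔮) := by
      intro i; fin_cases i
      · exact hXY𝔮 0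
      · exact hXY𝔮 1
    have hfun : (fun i => (maximalIdeal (Localization.AtPrime 𝔮)).toCotangent
          ⟨algebraMap A _ ((![x, g] : Fin 2 → A) i), hXY𝔮 i⟩) =
        (fun i => (maximalIdeal (Localization.AtPrime 𝔮)).toCotangent
          ⟨(![algebraMap A (Localization.AtPrime 𝔮) x, algebraMap A (Localization.AtPrime 𝔮) g] : Fin 2 → _) i,
            hXY i⟩) := by
      funext i; fin_cases i <;> rfl
    rw [hfun] at hli𝔮
    rw [← cylinderAt_localization jContact jContact_isoInvariant A 𝔭 𝔮 h𝔭𝔮 F m, cylinderAt_def,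
      ← IsScalarTower.algebraMap_apply A (Localization.AtPrime 𝔮) _ F]
    exact cylinder_open_presentation A 𝔭 x g F hx hg hxg' hg2 hF0 hnm hreach hb 𝔮 h𝔭𝔮 hXY hli𝔮 m
  case hiff =>
    -- (ι₀-IFF) on `D(h₁ f hb₀ h_τ) ∩ {dim ≤ 3}`
    intro 𝔮 _ hh𝔮 hdim𝔮
    have hh₁𝔮 : h₁ ∉ 𝔮 := fun h => hh𝔮 (Ideal.mul_mem_right _ _ (Ideal.mul_mem_right _ _ (Ideal.mul_mem_right _ _ h)))
    constructor
    · intro h𝔭𝔮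
      obtain ⟨hν, hε, hτ'⟩ := hletters 𝔮 hh𝔮 h𝔭𝔮 hdim𝔮
      obtain ⟨-, hε𝔪, hτ𝔪⟩ := hletters𝔪
      refine ⟨((hiff 𝔮 hh₁𝔮).mp h𝔭𝔮).1, ?_⟩
      rw [iotaOrdEpsTau_eq_iff, iotaOrdEps_eq_iff, hε, hε𝔪, hτ', hτ𝔪]
      exact ⟨⟨hν, rfl⟩, rfl⟩
    · rintro ⟨hF2, hι₀⟩
      exact (hiff 𝔮 hh₁𝔮).mpr ⟨hF2, ((iotaOrdEps_eq_iff _ _ _ _).mp ((iotaOrdEpsTau_eq_iff _ _ _ _).mp hι₀).1).1⟩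
  -- conclusion
  obtain ⟨h, hh, H⟩ := key
  exact ⟨h, hh, 2, ![x, g], ![1, bMax (algebraMap A (Localization.AtPrime 𝔭) F)], hW, ⟨hU𝔪, hli𝔪⟩,
    fun 𝔮 _ hh𝔮 hdim𝔮 => H 𝔮 hh𝔮 hdim𝔮⟩

end JOpenLE3

end Summit.ResolutionOfSingularities.ResolutionOfSingularities.Theorems

end
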